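import Mathlib
import Literature.Computability.AlgebraicComplexity.NestFreeMatchingPoly
import Summits.ValiantsHypothesis.ValiantsHypothesis.Theorems.FifoMatchingNNDivisionHardStackPowersQueueDefs
import HarnessLib

/-!
# Route FifoMatching — crux `NNDivisionHard` (stmt-ValiantsHypothesis-21181): the PIN BLOCK — gluing nest-free matchings

Combinatorics of the pin matching of `…NNDivisionHardStackPowersQueueDefs` (block size `a`, `4a+2 ≤ 2n`, `n ≤ 3a+1`):

* `pinNat_lt`, `le_pinNat`, `pinNat_ne`, `pinNat_pinNat`, `pin_not_nested`, `pinNat_base` — the pins form a fixed-point-free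
  NEST-FREE involution of the block `[2a, 2n)` whose first arc is the rainbow arc `(2a, 2n−1−2a)` (linear arithmetic);
* `val_glue_of_lt`, `val_glue_of_le`, `glue_injective`, ★ `glue_mem_nestFreeMatchings` — gluing a nest-free perfect matching
  `N` of the left block `[0, 2a)` with the pins gives a nest-free perfect matching of `[0, 2n)` (the pins lie to the right
  of the left block, so no arc of `N` nests with a pin);
* `stable_of_agree`, `restrictM_mem`, `glue_restrictM` — conversely a nest-free perfect matching of `[0, 2n)` that FOLLOWS
  THE PINS on `[2a, 2n)` stabilises the left block and is the gluing of its restriction;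
* `shiftMatching_mem` — the left block has a nest-free perfect matching (`i ↦ i ± a`).

Used by `…NNDivisionHardPinnedRainbowFace` (the `w`-maximal nest-free matchings in the pinned rainbow direction are exactly
the gluings).  HONEST FRAMING: elementary combinatorics; nothing here bears on the crux, `NNNotVP` or VP ≠ VNP.
References: Chen–Deng–Du–Stanley–Yan 2007 §1 [ChenDengDuStanleyYan2007].
-/

noncomputable section

-- Sub = Summit single-conjunct layout: the duplicated namespace component is mandated by the tree.
set_option linter.dupNamespace false
set_option autoImplicit false

namespace Summit.ValiantsHypothesis.ValiantsHypothesis.Theorems.FifoMatching.NNDivisionHard.StackPowersQueue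

open Finset Literature.Computability.AlgebraicComplexity

variable {n a : ℕ}

/-! ### §1 The pin matching of the block `[2a, 2n)` -/

/-- The pins stay inside `[0, 2n)`. [folklore] -/
theorem pinNat_lt (h1 : 4 * a + 2 ≤ 2 * n) (h2 : n ≤ 3 * a + 1) {p : ℕ} (hp : p < 2 * n) :
    pinNat n a p < 2 * n := by
  unfold pinNat; split_ifs <;> omega

/-- The pins stay inside the block `[2a, 2n)`. [folklore] -/
theorem le_pinNat (h1 : 4 * a + 2 ≤ 2 * n) (p : ℕ) : 2 * a ≤ pinNat n a p := by
  unfold pinNat; split_ifs <;> omega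

/-- The pin matching is fixed-point free. [folklore] -/
theorem pinNat_ne (h1 : 4 * a + 2 ≤ 2 * n) {p : ℕ} (hp : 2 * a ≤ p) : pinNat n a p ≠ p := by
  unfold pinNat; split_ifs <;> omega

/-- The first pin is the rainbow arc `(2a, 2n−2a−1)`. [folklore] -/
theorem pinNat_base (n a : ℕ) : pinNat n a (2 * a) = 2 * n - 2 * a - 1 := by
  simp [pinNat]

/-- The pin matching is an involution on the block. [folklore] -/
theorem pinNat_pinNat (h1 : 4 * a + 2 ≤ 2 * n) (h2 : n ≤ 3 * a + 1) {p : ℕ} (hp : 2 * a ≤ p)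
    (hp' : p < 2 * n) : pinNat n a (pinNat n a p) = p := by
  generalize hv : 2 * n - 4 * a - 1 = v
  have key : ∀ r, r = pinNat n a p → pinNat n a r = p := by
    intro r hr
    unfold pinNat at hr
    unfold pinNat
    rw [hv] at hr ⊢
    split_ifs at hr <;> split_ifs <;> omega
  exact key _ rfl

/-- The pin matching is NEST-FREE: no two pins `p < p' < pin p' < pin p`. [folklore] -/
theorem pin_not_nested (h1 : 4 * a + 2 ≤ 2 * n) {p p' : ℕ} (hp : 2 * a ≤ p)
    (hpp' : p < p') (h3 : p' < pinNat n a p') (h4 : pinNat n a p' < pinNat n a p) : False := by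
  generalize hv : 2 * n - 4 * a - 1 = v at h3 h4
  revert h3 h4
  unfold pinNat
  rw [hv]
  intro h3 h4
  split_ifs at h3 h4 <;> omega

/-! ### §2 Gluing a matching of `[0, 2a)` with the pins -/

/-- Value of `pinFin`. [folklore] -/
theorem val_pinFin (h1 : 4 * a + 2 ≤ 2 * n) (h2 : n ≤ 3 * a + 1) (p : Fin (2 * n)) :
    (pinFin n a p : ℕ) = pinNat n a p :=
  Nat.mod_eq_of_lt (pinNat_lt h1 h2 p.isLt)

/-- Value of the glued map on the left block. [folklore] -/
theorem val_glue_of_lt (h1 : 4 * a + 2 ≤ 2 * n) (N : Fin (2 * a) → Fin (2 * a)) {i : Fin (2 * n)}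
    (h : (i : ℕ) < 2 * a) : (glue n a N i : ℕ) = N ⟨i, h⟩ := by
  change (if h : (i : ℕ) < 2 * a then ((N ⟨i, h⟩ : Fin (2 * a)) : ℕ) else pinNat n a i) % (2 * n) = _
  rw [dif_pos h]
  exact Nat.mod_eq_of_lt (by have := (N ⟨i, h⟩).isLt; omega)

/-- Value of the glued map on the pin block. [folklore] -/
theorem val_glue_of_le (h1 : 4 * a + 2 ≤ 2 * n) (h2 : n ≤ 3 * a + 1) (N : Fin (2 * a) → Fin (2 * a))
    {i : Fin (2 * n)} (h : 2 * a ≤ (i : ℕ)) : (glue n a N i : ℕ) = pinNat n a i := by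
  change (if h : (i : ℕ) < 2 * a then ((N ⟨i, h⟩ : Fin (2 * a)) : ℕ) else pinNat n a i) % (2 * n) = _
  rw [dif_neg (not_lt.2 h)]
  exact Nat.mod_eq_of_lt (pinNat_lt h1 h2 i.isLt)

/-- The glued map is injective in `N`. [folklore] -/
theorem glue_injective (h1 : 4 * a + 2 ≤ 2 * n) : Function.Injective (glue n a) := by
  intro N N' h
  funext j
  apply Fin.ext
  have hj : ((⟨j, by omega⟩ : Fin (2 * n)) : ℕ) < 2 * a := j.isLt
  have e := congrArg (fun f => (f ⟨j, by omega⟩ : ℕ)) h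
  rw [val_glue_of_lt h1 N hj, val_glue_of_lt h1 N' hj] at e
  exact e

/-- **Gluing a nest-free perfect matching of `[0, 2a)` with the pins gives a nest-free perfect matching of `[0, 2n)`**
(the pins are nest-free among themselves and lie to the right of the left block). [folklore] -/
theorem glue_mem_nestFreeMatchings (h1 : 4 * a + 2 ≤ 2 * n) (h2 : n ≤ 3 * a + 1) {N : Fin (2 * a) → Fin (2 * a)}
    (hN : N ∈ nestFreeMatchings (2 * a)) : glue n a N ∈ nestFreeMatchings (2 * n) := by
  rw [mem_nestFreeMatchings, mem_perfectMatchings] at hN ⊢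
  obtain ⟨⟨hinv, hfp⟩, hnest⟩ := hN
  refine ⟨⟨fun i => Fin.ext ?_, fun i heq => ?_⟩, fun i j hij hj hji => ?_⟩
  · by_cases h : (i : ℕ) < 2 * a
    · have hgi := val_glue_of_lt h1 N h
      have hlt : (glue n a N i : ℕ) < 2 * a := by rw [hgi]; exact (N ⟨i, h⟩).isLt
      rw [val_glue_of_lt h1 N hlt]
      have : (⟨(glue n a N i : ℕ), hlt⟩ : Fin (2 * a)) = N ⟨i, h⟩ := Fin.ext hgi
      rw [this, hinv]
    · push Not at h
      have hgi := val_glue_of_le h1 h2 N h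
      have hge : 2 * a ≤ (glue n a N i : ℕ) := by rw [hgi]; exact le_pinNat h1 _
      rw [val_glue_of_le h1 h2 N hge, hgi]
      exact pinNat_pinNat h1 h2 h i.isLt
  · have hv := congrArg Fin.val heq
    by_cases h : (i : ℕ) < 2 * a
    · rw [val_glue_of_lt h1 N h] at hv
      exact hfp ⟨i, h⟩ (Fin.ext hv)
    · push Not at h
      rw [val_glue_of_le h1 h2 N h] at hv
      exact pinNat_ne h1 h hv
  · rw [Fin.lt_def] at hij hj hji
    by_cases hi : (i : ℕ) < 2 * a
    · by_cases hj' : (j : ℕ) < 2 * a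
      · rw [val_glue_of_lt h1 N hi] at hji
        rw [val_glue_of_lt h1 N hj'] at hj hji
        exact hnest ⟨i, hi⟩ ⟨j, hj'⟩ (Fin.mk_lt_mk.2 hij) (Fin.lt_def.2 hj) (Fin.lt_def.2 hji)
      · push Not at hj'
        rw [val_glue_of_lt h1 N hi, val_glue_of_le h1 h2 N hj'] at hji
        have := le_pinNat h1 (n := n) (j : ℕ)
        have := (N ⟨i, hi⟩).isLt
        omega
    · push Not at hi
      have hj' : 2 * a ≤ (j : ℕ) := by omega
      rw [val_glue_of_le h1 h2 N hj'] at hj hji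
      rw [val_glue_of_le h1 h2 N hi] at hji
      exact pin_not_nested h1 hi hij hj hji

/-- Value of the restriction when `M` stabilises the left block. [folklore] -/
theorem val_restrictM (hle : 2 * a ≤ 2 * n) {M : Fin (2 * n) → Fin (2 * n)}
    (hM : ∀ i : Fin (2 * n), (i : ℕ) < 2 * a → (M i : ℕ) < 2 * a) (j : Fin (2 * a)) :
    (restrictM hle M j : ℕ) = M (Fin.castLE hle j) :=
  Nat.mod_eq_of_lt (hM _ (by rw [Fin.val_castLE]; exact j.isLt))

/-- A perfect matching of `[0, 2n)` that follows the pins on `[2a, 2n)` stabilises the left block. [folklore] -/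
theorem stable_of_agree (h1 : 4 * a + 2 ≤ 2 * n) {M : Fin (2 * n) → Fin (2 * n)}
    (hM : M ∈ perfectMatchings (2 * n)) (hagree : ∀ p : Fin (2 * n), 2 * a ≤ (p : ℕ) → (M p : ℕ) = pinNat n a p) :
    ∀ i : Fin (2 * n), (i : ℕ) < 2 * a → (M i : ℕ) < 2 * a := by
  intro i hi
  by_contra h
  push Not at h
  have h3 := hagree (M i) h
  rw [(mem_perfectMatchings.1 hM).1 i] at h3
  have := le_pinNat h1 (n := n) (M i : ℕ)
  omega

/-- The restriction of a nest-free perfect matching following the pins is a nest-free perfect matching of `[0, 2a)`.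
[folklore] -/
theorem restrictM_mem (h1 : 4 * a + 2 ≤ 2 * n) (hle : 2 * a ≤ 2 * n) {M : Fin (2 * n) → Fin (2 * n)}
    (hM : M ∈ nestFreeMatchings (2 * n)) (hagree : ∀ p : Fin (2 * n), 2 * a ≤ (p : ℕ) → (M p : ℕ) = pinNat n a p) :
    restrictM hle M ∈ nestFreeMatchings (2 * a) := by
  have hPM := nestFreeMatchings_subset_perfectMatchings hM
  have hst := stable_of_agree h1 hPM hagree
  obtain ⟨hinv, hfp⟩ := mem_perfectMatchings.1 hPM
  have hnest := (mem_nestFreeMatchings.1 hM).2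
  have hcast : ∀ j : Fin (2 * a), Fin.castLE hle (restrictM hle M j) = M (Fin.castLE hle j) := fun j =>
    Fin.ext (by rw [Fin.val_castLE, val_restrictM hle hst])
  rw [mem_nestFreeMatchings, mem_perfectMatchings]
  refine ⟨⟨fun j => Fin.ext ?_, fun j heq => ?_⟩, fun i j hij hj hji => ?_⟩
  · rw [val_restrictM hle hst, hcast, hinv, Fin.val_castLE]
  · have hv := congrArg Fin.val heq
    rw [val_restrictM hle hst] at hv
    exact hfp (Fin.castLE hle j) (Fin.ext (by rw [hv, Fin.val_castLE]))
  · rw [Fin.lt_def] at hij hj hji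
    rw [val_restrictM hle hst] at hj hji
    rw [val_restrictM hle hst] at hji
    refine hnest (Fin.castLE hle i) (Fin.castLE hle j) ?_ ?_ ?_
    · rw [Fin.lt_def, Fin.val_castLE, Fin.val_castLE]; exact hij
    · rw [Fin.lt_def, Fin.val_castLE]; exact hj
    · rw [Fin.lt_def]; exact hji

/-- A nest-free perfect matching following the pins IS the gluing of its restriction with the pins. [folklore] -/
theorem glue_restrictM (h1 : 4 * a + 2 ≤ 2 * n) (h2 : n ≤ 3 * a + 1) (hle : 2 * a ≤ 2 * n)
    {M : Fin (2 * n) → Fin (2 * n)} (hM : M ∈ perfectMatchings (2 * n))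
    (hagree : ∀ p : Fin (2 * n), 2 * a ≤ (p : ℕ) → (M p : ℕ) = pinNat n a p) :
    glue n a (restrictM hle M) = M := by
  have hst := stable_of_agree h1 hM hagree
  funext i
  apply Fin.ext
  by_cases h : (i : ℕ) < 2 * a
  · rw [val_glue_of_lt h1 _ h, val_restrictM hle hst]
    congr 1
  · push Not at h
    rw [val_glue_of_le h1 h2 _ h, hagree i h]

/-- The shift matching is a nest-free perfect matching. [folklore] -/
theorem shiftMatching_mem (a : ℕ) : shiftMatching a ∈ nestFreeMatchings (2 * a) := by
  rw [mem_nestFreeMatchings, mem_perfectMatchings]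
  refine ⟨⟨fun i => Fin.ext ?_, fun i heq => ?_⟩, fun i j hij hj hji => ?_⟩
  · have := i.isLt
    simp only [shiftMatching]
    split_ifs <;> omega
  · have hv := congrArg Fin.val heq
    have := i.isLt
    simp only [shiftMatching] at hv
    split_ifs at hv <;> omega
  · rw [Fin.lt_def] at hij hj hji
    have := i.isLt
    have := j.isLt
    simp only [shiftMatching] at hj hji
    split_ifs at hj hji <;> omega

end Summit.ValiantsHypothesis.ValiantsHypothesis.Theorems.FifoMatching.NNDivisionHard.StackPowersQueue

end
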